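import Summits.HodgeConjecture.CorCM.IrreducibleOddWeightsMultiClassRank
import Summits.HodgeConjecture.CorCM.IrreducibleOddWeightsHodgeEquivalence
import HarnessLib

/-!
# The multiplicity formula across all isotypic classes, VIII: HODGE DOMINATION AND EQUIVALENCE OF TWO SLOTS —
# `S(W′) ≤ S(W) ⟺ ∀ c, D_c⟨b′_c⟩ ≤ D_c⟨b_c⟩`, `S(W′) = S(W) ⟺ ∀ c, D_c⟨b′_c⟩ = D_c⟨b_c⟩`;
# `MC₁ = MC₀ ⟺ rank(Φ₀,Φ₁) = rank Φ₀ = rank Φ₁ ⟺ ∀ c, D_c⟨b¹_c⟩ = D_c⟨b⁰_c⟩`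

COR-CM (cell `pub-hodgecm2`, binder seat `b16` gen 75, count-neutral claim THE MULTIPLICITY FORMULA ACROSS ALL
ISOTYPIC CLASSES FOR A WHOLE FAMILY, file M8 — abstract `G`-set level and type ranks; theorems only, no definition,
no named fact, no `sorry`).  NEW as stated, hence under `Summits/`.  HONEST FRAMING: linear algebra of translates of
functions on finite `G`-sets (files M1–M5, gen 72 C6 `…CommutantDensityMeet`, gen 74 S2 `…HodgeEquivalence`);
nothing about Hodge classes is asserted, `HC_CM` is neither used nor asserted.  Gen 74 S2 read Hodge equivalence
`MC₀ = MC₁` inside ONE isotypic class (`⟺ D⟨b⟩ = D⟨b′⟩`); gen 74 S7 decided PAIR domination over all classes in gen 73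
K6's currency (labelled constituents, a trace pivot on one side).  This file states both slots symmetrically in the
reference-irreducible currency of files M1–M5.

SETTING (files M1–M5).  Pairwise non-isomorphic reference irreducibles `A_c ≤ ℚ^{Y_c}` (`A_c ≠ 0`, commutant
`𝒟_c` ANY); two slots `Y₀`, `Y₁` with vectors `W = Σ_c p_c`, `W′ = Σ_c p′_c`, class parts `p_c = Σ_j ι_{c,j}(b_{c,j})`,
`p′_c = Σ_k ι′_{c,k}(b′_{c,k})` (equivariant embeddings jointly independent on `A_c`, components in `A_c`).

* §1 **`S(W′) ≤ S(W) ⟺ ∀ c, S(p′_c) ≤ S(p_c)`** (`span_shadowCoeff_le_iff_forall_of_classes`; M2's lattice step) and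
  `S(W′) = S(W) ⟺ ∀ c, S(p′_c) = S(p_c)`; over the commutants **`⟺ ∀ c, D_c⟨b′_c⟩ ≤ D_c⟨b_c⟩`** resp.
  **`⟺ ∀ c, D_c⟨b′_c⟩ = D_c⟨b_c⟩`** (C6 class by class).
* §2 TYPE RANKS for two members `i₀, i₁` of a family of CM types decomposed over the references:
  `MC_{i₁} ≤ MC_{i₀} ⟺ ∀ c, D_c⟨b^{i₁}_c⟩ ≤ D_c⟨b^{i₀}_c⟩`; **HODGE EQUIVALENCE `MC_{i₁} = MC_{i₀} ⟺ ∀ c, D_c⟨b^{i₁}_c⟩ =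
  D_c⟨b^{i₀}_c⟩`**; for a pair `I = {i₀, i₁}`: **`rank(Φ₀,Φ₁) = rank Φ₀ ⟺ ∀ c, D_c⟨b¹_c⟩ ≤ D_c⟨b⁰_c⟩`**
  (`typeRank_pair_eq_typeRank_iff_forall_iSup_le_of_classes`) and **`rank(Φ₀,Φ₁) = rank Φ₀ ∧ rank(Φ₀,Φ₁) = rank Φ₁
  ⟺ ∀ c, D_c⟨b¹_c⟩ = D_c⟨b⁰_c⟩`**; CM dress in `…CorCM`.

## References

* [Deligne1982HodgeCycles] P. Deligne, *Hodge cycles on abelian varieties*, LNM 900 (1982), I.5 (p. 53).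
* [Gordon1999HodgeAVSurvey] B. B. Gordon, *A survey of the Hodge conjecture for abelian varieties*, §3 Theorem (proof),
  7.5–7.7, 9.4.3.
* [Lang2002] S. Lang, *Algebra*, 3rd ed., XVII §1, XVII §3.
* [Serre1977] J.-P. Serre, *Linear Representations of Finite Groups*, GTM 42, §2.6.
-/

set_option autoImplicit false

noncomputable section

open scoped BigOperators Classical

universe u uC uJ uJ' v v' v'' vC w

namespace Summit.HodgeConjecture.CorCM.IrrOdd

open Literature.NumberTheory.ComplexMultiplication

variable {G : Type w} [Group G]
  {C : Type uC} [Fintype C] {Yc : C → Type vC} [∀ c, MulAction G (Yc c)] [∀ c, Fintype (Yc c)]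
  {Ar : ∀ c, Submodule ℚ (Yc c → ℚ)} {𝒟 : ∀ c, Submodule ℚ ((Yc c → ℚ) →ₗ[ℚ] (Yc c → ℚ))}

/-! ### §1 Two slots -/

section TwoSlots

variable {Y₀ : Type v'} [MulAction G Y₀] [Fintype Y₀] {Y₁ : Type v''} [MulAction G Y₁] [Fintype Y₁]
  {J₀ : C → Type uJ} [∀ c, Fintype (J₀ c)] {J₁ : C → Type uJ'} [∀ c, Fintype (J₁ c)]

/-- **`S(W′) ≤ S(W) ⟺ ∀ c, S(p′_c) ≤ S(p_c)`** — a slot is absorbed by another iff every class part is absorbed by the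
corresponding class part (the class parts lie in the independent containers, file M2).  [cite: Serre1977, §2.6]
[cite: Gordon1999HodgeAVSurvey, §3 Theorem (proof), 7.5–7.7] -/
theorem span_shadowCoeff_le_iff_forall_of_classes
    (hRst : ∀ c (k : G) (a : Yc c → ℚ), a ∈ Ar c → (fun y => a (k • y)) ∈ Ar c)
    (hRirr : ∀ c (W : Submodule ℚ (Yc c → ℚ)), W ≤ Ar c → W ≠ ⊥ →
      (∀ (k : G) (f : Yc c → ℚ), f ∈ W → (fun y => f (k • y)) ∈ W) → W = Ar c)
    (hsep : ∀ c c' (L : (Yc c → ℚ) →ₗ[ℚ] (Yc c' → ℚ)), c ≠ c' → Ar c ≠ ⊥ → (∀ a ∈ Ar c, L a ∈ Ar c') →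
      (∀ a ∈ Ar c, L a = 0 → a = 0) →
      (∀ (k : G) (a : Yc c → ℚ), a ∈ Ar c → L (fun y => a (k • y)) = fun y => L a (k • y)) → False)
    (ι₀ : ∀ c, J₀ c → ((Yc c → ℚ) →ₗ[ℚ] (Y₀ → ℚ))) (ι₁ : ∀ c, J₁ c → ((Yc c → ℚ) →ₗ[ℚ] (Y₁ → ℚ)))
    (hι₀eq : ∀ c (j : J₀ c) (k : G) (a : Yc c → ℚ), a ∈ Ar c →
      ι₀ c j (fun y => a (k • y)) = fun y => ι₀ c j a (k • y))
    (hι₁eq : ∀ c (j : J₁ c) (k : G) (a : Yc c → ℚ), a ∈ Ar c →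
      ι₁ c j (fun y => a (k • y)) = fun y => ι₁ c j a (k • y))
    (hind₀ : ∀ c (f : J₀ c → (Yc c → ℚ)), (∀ j, f j ∈ Ar c) → ∑ j, ι₀ c j (f j) = 0 → ∀ j, f j = 0)
    (hind₁ : ∀ c (f : J₁ c → (Yc c → ℚ)), (∀ j, f j ∈ Ar c) → ∑ j, ι₁ c j (f j) = 0 → ∀ j, f j = 0)
    {b₀ : ∀ c, J₀ c → (Yc c → ℚ)} {b₁ : ∀ c, J₁ c → (Yc c → ℚ)}
    (hb₀ : ∀ c j, b₀ c j ∈ Ar c) (hb₁ : ∀ c j, b₁ c j ∈ Ar c) :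
    Submodule.span ℚ (Set.range fun y : Y₁ => fun g : G => (∑ c, ∑ j, ι₁ c j (b₁ c j)) (g • y)) ≤
        Submodule.span ℚ (Set.range fun y : Y₀ => fun g : G => (∑ c, ∑ j, ι₀ c j (b₀ c j)) (g • y)) ↔
      ∀ c, Submodule.span ℚ (Set.range fun y : Y₁ => fun g : G => (∑ j, ι₁ c j (b₁ c j)) (g • y)) ≤
        Submodule.span ℚ (Set.range fun y : Y₀ => fun g : G => (∑ j, ι₀ c j (b₀ c j)) (g • y)) := by
  rw [span_shadowCoeff_sum_classes_eq_iSup hRst hRirr hsep ι₀ hι₀eq hind₀ hb₀,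
    span_shadowCoeff_sum_classes_eq_iSup hRst hRirr hsep ι₁ hι₁eq hind₁ hb₁]
  constructor
  · intro h c
    exact le_of_le_iSup_of_iSupIndep (iSupIndep_container_of_classes hRst hRirr hsep)
      (fun c' => span_shadowCoeff_sum_le_container (ι₀ c') (hι₀eq c') (hb₀ c'))
      (span_shadowCoeff_sum_le_container (ι₁ c) (hι₁eq c) (hb₁ c)) ((le_iSup _ c).trans h)
  · exact fun h => iSup_mono h

/-- **`S(W′) = S(W) ⟺ ∀ c, S(p′_c) = S(p_c)`**. [cite: Serre1977, §2.6]
[cite: Gordon1999HodgeAVSurvey, §3 Theorem (proof), 7.5–7.7] -/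
theorem span_shadowCoeff_eq_iff_forall_of_classes
    (hRst : ∀ c (k : G) (a : Yc c → ℚ), a ∈ Ar c → (fun y => a (k • y)) ∈ Ar c)
    (hRirr : ∀ c (W : Submodule ℚ (Yc c → ℚ)), W ≤ Ar c → W ≠ ⊥ →
      (∀ (k : G) (f : Yc c → ℚ), f ∈ W → (fun y => f (k • y)) ∈ W) → W = Ar c)
    (hsep : ∀ c c' (L : (Yc c → ℚ) →ₗ[ℚ] (Yc c' → ℚ)), c ≠ c' → Ar c ≠ ⊥ → (∀ a ∈ Ar c, L a ∈ Ar c') →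
      (∀ a ∈ Ar c, L a = 0 → a = 0) →
      (∀ (k : G) (a : Yc c → ℚ), a ∈ Ar c → L (fun y => a (k • y)) = fun y => L a (k • y)) → False)
    (ι₀ : ∀ c, J₀ c → ((Yc c → ℚ) →ₗ[ℚ] (Y₀ → ℚ))) (ι₁ : ∀ c, J₁ c → ((Yc c → ℚ) →ₗ[ℚ] (Y₁ → ℚ)))
    (hι₀eq : ∀ c (j : J₀ c) (k : G) (a : Yc c → ℚ), a ∈ Ar c →
      ι₀ c j (fun y => a (k • y)) = fun y => ι₀ c j a (k • y))
    (hι₁eq : ∀ c (j : J₁ c) (k : G) (a : Yc c → ℚ), a ∈ Ar c →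
      ι₁ c j (fun y => a (k • y)) = fun y => ι₁ c j a (k • y))
    (hind₀ : ∀ c (f : J₀ c → (Yc c → ℚ)), (∀ j, f j ∈ Ar c) → ∑ j, ι₀ c j (f j) = 0 → ∀ j, f j = 0)
    (hind₁ : ∀ c (f : J₁ c → (Yc c → ℚ)), (∀ j, f j ∈ Ar c) → ∑ j, ι₁ c j (f j) = 0 → ∀ j, f j = 0)
    {b₀ : ∀ c, J₀ c → (Yc c → ℚ)} {b₁ : ∀ c, J₁ c → (Yc c → ℚ)}
    (hb₀ : ∀ c j, b₀ c j ∈ Ar c) (hb₁ : ∀ c j, b₁ c j ∈ Ar c) :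
    Submodule.span ℚ (Set.range fun y : Y₁ => fun g : G => (∑ c, ∑ j, ι₁ c j (b₁ c j)) (g • y)) =
        Submodule.span ℚ (Set.range fun y : Y₀ => fun g : G => (∑ c, ∑ j, ι₀ c j (b₀ c j)) (g • y)) ↔
      ∀ c, Submodule.span ℚ (Set.range fun y : Y₁ => fun g : G => (∑ j, ι₁ c j (b₁ c j)) (g • y)) =
        Submodule.span ℚ (Set.range fun y : Y₀ => fun g : G => (∑ j, ι₀ c j (b₀ c j)) (g • y)) := by
  simp only [le_antisymm_iff]
  rw [span_shadowCoeff_le_iff_forall_of_classes hRst hRirr hsep ι₀ ι₁ hι₀eq hι₁eq hind₀ hind₁ hb₀ hb₁,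
    span_shadowCoeff_le_iff_forall_of_classes hRst hRirr hsep ι₁ ι₀ hι₁eq hι₀eq hind₁ hind₀ hb₁ hb₀, ← forall_and]

/-- **DOMINATION OF ONE SLOT BY ANOTHER OVER THE COMMUTANTS: `S(W′) ≤ S(W) ⟺ ∀ c, D_c⟨b′_c⟩ ≤ D_c⟨b_c⟩`** — in every
class the components of `W′` are `D_c`-combinations of those of `W` (C6 class by class). [cite: Lang2002, XVII §3]
[cite: Deligne1982HodgeCycles, I.5 (p. 53)] [cite: Gordon1999HodgeAVSurvey, §3 Theorem (proof), 7.5–7.7] -/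
theorem span_shadowCoeff_le_iff_forall_iSup_le_of_classes
    (h𝒟 : ∀ c (L : (Yc c → ℚ) →ₗ[ℚ] (Yc c → ℚ)), L ∈ 𝒟 c ↔ (∀ a ∈ Ar c, L a ∈ Ar c) ∧
      ∀ (k : G) (a : Yc c → ℚ), a ∈ Ar c → L (fun y => a (k • y)) = fun y => L a (k • y))
    (hRst : ∀ c (k : G) (a : Yc c → ℚ), a ∈ Ar c → (fun y => a (k • y)) ∈ Ar c)
    (hRirr : ∀ c (W : Submodule ℚ (Yc c → ℚ)), W ≤ Ar c → W ≠ ⊥ →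
      (∀ (k : G) (f : Yc c → ℚ), f ∈ W → (fun y => f (k • y)) ∈ W) → W = Ar c)
    (hR0 : ∀ c, Ar c ≠ ⊥)
    (hsep : ∀ c c' (L : (Yc c → ℚ) →ₗ[ℚ] (Yc c' → ℚ)), c ≠ c' → Ar c ≠ ⊥ → (∀ a ∈ Ar c, L a ∈ Ar c') →
      (∀ a ∈ Ar c, L a = 0 → a = 0) →
      (∀ (k : G) (a : Yc c → ℚ), a ∈ Ar c → L (fun y => a (k • y)) = fun y => L a (k • y)) → False)
    (ι₀ : ∀ c, J₀ c → ((Yc c → ℚ) →ₗ[ℚ] (Y₀ → ℚ))) (ι₁ : ∀ c, J₁ c → ((Yc c → ℚ) →ₗ[ℚ] (Y₁ → ℚ)))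
    (hι₀eq : ∀ c (j : J₀ c) (k : G) (a : Yc c → ℚ), a ∈ Ar c →
      ι₀ c j (fun y => a (k • y)) = fun y => ι₀ c j a (k • y))
    (hι₁eq : ∀ c (j : J₁ c) (k : G) (a : Yc c → ℚ), a ∈ Ar c →
      ι₁ c j (fun y => a (k • y)) = fun y => ι₁ c j a (k • y))
    (hind₀ : ∀ c (f : J₀ c → (Yc c → ℚ)), (∀ j, f j ∈ Ar c) → ∑ j, ι₀ c j (f j) = 0 → ∀ j, f j = 0)
    (hind₁ : ∀ c (f : J₁ c → (Yc c → ℚ)), (∀ j, f j ∈ Ar c) → ∑ j, ι₁ c j (f j) = 0 → ∀ j, f j = 0)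
    {b₀ : ∀ c, J₀ c → (Yc c → ℚ)} {b₁ : ∀ c, J₁ c → (Yc c → ℚ)}
    (hb₀ : ∀ c j, b₀ c j ∈ Ar c) (hb₁ : ∀ c j, b₁ c j ∈ Ar c) :
    Submodule.span ℚ (Set.range fun y : Y₁ => fun g : G => (∑ c, ∑ j, ι₁ c j (b₁ c j)) (g • y)) ≤
        Submodule.span ℚ (Set.range fun y : Y₀ => fun g : G => (∑ c, ∑ j, ι₀ c j (b₀ c j)) (g • y)) ↔
      ∀ c, (⨆ j, (𝒟 c).map (LinearMap.applyₗ (b₁ c j))) ≤ ⨆ j, (𝒟 c).map (LinearMap.applyₗ (b₀ c j)) := by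
  rw [span_shadowCoeff_le_iff_forall_of_classes hRst hRirr hsep ι₀ ι₁ hι₀eq hι₁eq hind₀ hind₁ hb₀ hb₁]
  exact forall_congr' fun c => span_shadowCoeff_le_iff_iSup_le (h𝒟 c) (hRst c) (hRirr c) (hR0 c) (ι₀ c) (ι₁ c)
    (hι₀eq c) (hι₁eq c) (hind₀ c) (hind₁ c) (hb₀ c) (hb₁ c)

/-- **EQUIVALENCE OF TWO SLOTS OVER THE COMMUTANTS: `S(W′) = S(W) ⟺ ∀ c, D_c⟨b′_c⟩ = D_c⟨b_c⟩`**.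
[cite: Lang2002, XVII §3] [cite: Deligne1982HodgeCycles, I.5 (p. 53)]
[cite: Gordon1999HodgeAVSurvey, §3 Theorem (proof), 7.5–7.7] -/
theorem span_shadowCoeff_eq_iff_forall_iSup_eq_of_classes
    (h𝒟 : ∀ c (L : (Yc c → ℚ) →ₗ[ℚ] (Yc c → ℚ)), L ∈ 𝒟 c ↔ (∀ a ∈ Ar c, L a ∈ Ar c) ∧
      ∀ (k : G) (a : Yc c → ℚ), a ∈ Ar c → L (fun y => a (k • y)) = fun y => L a (k • y))
    (hRst : ∀ c (k : G) (a : Yc c → ℚ), a ∈ Ar c → (fun y => a (k • y)) ∈ Ar c)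
    (hRirr : ∀ c (W : Submodule ℚ (Yc c → ℚ)), W ≤ Ar c → W ≠ ⊥ →
      (∀ (k : G) (f : Yc c → ℚ), f ∈ W → (fun y => f (k • y)) ∈ W) → W = Ar c)
    (hR0 : ∀ c, Ar c ≠ ⊥)
    (hsep : ∀ c c' (L : (Yc c → ℚ) →ₗ[ℚ] (Yc c' → ℚ)), c ≠ c' → Ar c ≠ ⊥ → (∀ a ∈ Ar c, L a ∈ Ar c') →
      (∀ a ∈ Ar c, L a = 0 → a = 0) →
      (∀ (k : G) (a : Yc c → ℚ), a ∈ Ar c → L (fun y => a (k • y)) = fun y => L a (k • y)) → False)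
    (ι₀ : ∀ c, J₀ c → ((Yc c → ℚ) →ₗ[ℚ] (Y₀ → ℚ))) (ι₁ : ∀ c, J₁ c → ((Yc c → ℚ) →ₗ[ℚ] (Y₁ → ℚ)))
    (hι₀eq : ∀ c (j : J₀ c) (k : G) (a : Yc c → ℚ), a ∈ Ar c →
      ι₀ c j (fun y => a (k • y)) = fun y => ι₀ c j a (k • y))
    (hι₁eq : ∀ c (j : J₁ c) (k : G) (a : Yc c → ℚ), a ∈ Ar c →
      ι₁ c j (fun y => a (k • y)) = fun y => ι₁ c j a (k • y))
    (hind₀ : ∀ c (f : J₀ c → (Yc c → ℚ)), (∀ j, f j ∈ Ar c) → ∑ j, ι₀ c j (f j) = 0 → ∀ j, f j = 0)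
    (hind₁ : ∀ c (f : J₁ c → (Yc c → ℚ)), (∀ j, f j ∈ Ar c) → ∑ j, ι₁ c j (f j) = 0 → ∀ j, f j = 0)
    {b₀ : ∀ c, J₀ c → (Yc c → ℚ)} {b₁ : ∀ c, J₁ c → (Yc c → ℚ)}
    (hb₀ : ∀ c j, b₀ c j ∈ Ar c) (hb₁ : ∀ c j, b₁ c j ∈ Ar c) :
    Submodule.span ℚ (Set.range fun y : Y₁ => fun g : G => (∑ c, ∑ j, ι₁ c j (b₁ c j)) (g • y)) =
        Submodule.span ℚ (Set.range fun y : Y₀ => fun g : G => (∑ c, ∑ j, ι₀ c j (b₀ c j)) (g • y)) ↔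
      ∀ c, (⨆ j, (𝒟 c).map (LinearMap.applyₗ (b₁ c j))) = ⨆ j, (𝒟 c).map (LinearMap.applyₗ (b₀ c j)) := by
  rw [span_shadowCoeff_eq_iff_forall_of_classes hRst hRirr hsep ι₀ ι₁ hι₀eq hι₁eq hind₀ hind₁ hb₀ hb₁]
  exact forall_congr' fun c => span_shadowCoeff_eq_iff_iSup_eq (h𝒟 c) (hRst c) (hRirr c) (hR0 c) (ι₀ c) (ι₁ c)
    (hι₀eq c) (hι₁eq c) (hind₀ c) (hind₁ c) (hb₀ c) (hb₁ c)

end TwoSlots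

/-! ### §2 Type ranks: two members -/

section Family

variable {I : Type u} {E : I → Type v} [∀ i, MulAction G (E i)] [∀ i, Fintype (E i)] [Fintype I]
  [∀ i, Nonempty (E i)] {JJ : I → C → Type uJ} [∀ i c, Fintype (JJ i c)]

omit [Fintype I] [∀ i, Nonempty (E i)] in
/-- **`MC_{i₁} ≤ MC_{i₀} ⟺ ∀ c, D_c⟨b^{i₁}_c⟩ ≤ D_c⟨b^{i₀}_c⟩`** — `A_{i₁}` is HODGE-DOMINATED by `A_{i₀}` iff, class by
class, its type components are `D_c`-combinations of those of `A_{i₀}`. [cite: Deligne1982HodgeCycles, I.5 (p. 53)]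
[cite: Gordon1999HodgeAVSurvey, §3 Theorem (proof), 7.5–7.7] [cite: Lang2002, XVII §3] -/
theorem span_coeff_le_iff_forall_iSup_le_of_classes (Φ : ∀ i, Set (E i)) (i₀ i₁ : I)
    (h𝒟 : ∀ c (L : (Yc c → ℚ) →ₗ[ℚ] (Yc c → ℚ)), L ∈ 𝒟 c ↔ (∀ a ∈ Ar c, L a ∈ Ar c) ∧
      ∀ (k : G) (a : Yc c → ℚ), a ∈ Ar c → L (fun y => a (k • y)) = fun y => L a (k • y))
    (hRst : ∀ c (k : G) (a : Yc c → ℚ), a ∈ Ar c → (fun y => a (k • y)) ∈ Ar c)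
    (hRirr : ∀ c (W : Submodule ℚ (Yc c → ℚ)), W ≤ Ar c → W ≠ ⊥ →
      (∀ (k : G) (f : Yc c → ℚ), f ∈ W → (fun y => f (k • y)) ∈ W) → W = Ar c)
    (hR0 : ∀ c, Ar c ≠ ⊥)
    (hsep : ∀ c c' (L : (Yc c → ℚ) →ₗ[ℚ] (Yc c' → ℚ)), c ≠ c' → Ar c ≠ ⊥ → (∀ a ∈ Ar c, L a ∈ Ar c') →
      (∀ a ∈ Ar c, L a = 0 → a = 0) →
      (∀ (k : G) (a : Yc c → ℚ), a ∈ Ar c → L (fun y => a (k • y)) = fun y => L a (k • y)) → False)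
    (ι : ∀ i c, JJ i c → ((Yc c → ℚ) →ₗ[ℚ] (E i → ℚ)))
    (hιeq : ∀ i c (j : JJ i c) (k : G) (a : Yc c → ℚ), a ∈ Ar c →
      ι i c j (fun y => a (k • y)) = fun y => ι i c j a (k • y))
    (hind : ∀ i c (f : JJ i c → (Yc c → ℚ)), (∀ j, f j ∈ Ar c) → ∑ j, ι i c j (f j) = 0 → ∀ j, f j = 0)
    {b : ∀ i c, JJ i c → (Yc c → ℚ)} (hb : ∀ i c j, b i c j ∈ Ar c)
    (hu : ∀ i, antiVec (Φ i) (1 : G) = ∑ c, ∑ j, ι i c j (b i c j)) :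
    Submodule.span ℚ (Set.range fun x : E i₁ => fun g : G => antiVec (Φ i₁) g x) ≤
        Submodule.span ℚ (Set.range fun x : E i₀ => fun g : G => antiVec (Φ i₀) g x) ↔
      ∀ c, (⨆ j, (𝒟 c).map (LinearMap.applyₗ (b i₁ c j))) ≤ ⨆ j, (𝒟 c).map (LinearMap.applyₗ (b i₀ c j)) := by
  rw [span_coeff_eq_span_shadowCoeff_of_eq Φ i₀ (hu i₀), span_coeff_eq_span_shadowCoeff_of_eq Φ i₁ (hu i₁)]
  exact span_shadowCoeff_le_iff_forall_iSup_le_of_classes h𝒟 hRst hRirr hR0 hsep (ι i₀) (ι i₁) (hιeq i₀) (hιeq i₁)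
    (hind i₀) (hind i₁) (hb i₀) (hb i₁)

omit [Fintype I] [∀ i, Nonempty (E i)] in
/-- **HODGE EQUIVALENCE ACROSS ALL ISOTYPIC CLASSES: `MC_{i₁} = MC_{i₀} ⟺ ∀ c, D_c⟨b^{i₁}_c⟩ = D_c⟨b^{i₀}_c⟩`** — the two
factors carry the same Hodge theory (both projections `MT(A_{i₀} × A_{i₁}) → MT(A_i)` isogenies) iff their type
components span the same `D_c`-submodule of `A_c` in every class. [cite: Deligne1982HodgeCycles, I.5 (p. 53)]
[cite: Gordon1999HodgeAVSurvey, §3 Theorem (proof), 7.7] [cite: Lang2002, XVII §3] -/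
theorem span_coeff_eq_iff_forall_iSup_eq_of_classes (Φ : ∀ i, Set (E i)) (i₀ i₁ : I)
    (h𝒟 : ∀ c (L : (Yc c → ℚ) →ₗ[ℚ] (Yc c → ℚ)), L ∈ 𝒟 c ↔ (∀ a ∈ Ar c, L a ∈ Ar c) ∧
      ∀ (k : G) (a : Yc c → ℚ), a ∈ Ar c → L (fun y => a (k • y)) = fun y => L a (k • y))
    (hRst : ∀ c (k : G) (a : Yc c → ℚ), a ∈ Ar c → (fun y => a (k • y)) ∈ Ar c)
    (hRirr : ∀ c (W : Submodule ℚ (Yc c → ℚ)), W ≤ Ar c → W ≠ ⊥ →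
      (∀ (k : G) (f : Yc c → ℚ), f ∈ W → (fun y => f (k • y)) ∈ W) → W = Ar c)
    (hR0 : ∀ c, Ar c ≠ ⊥)
    (hsep : ∀ c c' (L : (Yc c → ℚ) →ₗ[ℚ] (Yc c' → ℚ)), c ≠ c' → Ar c ≠ ⊥ → (∀ a ∈ Ar c, L a ∈ Ar c') →
      (∀ a ∈ Ar c, L a = 0 → a = 0) →
      (∀ (k : G) (a : Yc c → ℚ), a ∈ Ar c → L (fun y => a (k • y)) = fun y => L a (k • y)) → False)
    (ι : ∀ i c, JJ i c → ((Yc c → ℚ) →ₗ[ℚ] (E i → ℚ)))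
    (hιeq : ∀ i c (j : JJ i c) (k : G) (a : Yc c → ℚ), a ∈ Ar c →
      ι i c j (fun y => a (k • y)) = fun y => ι i c j a (k • y))
    (hind : ∀ i c (f : JJ i c → (Yc c → ℚ)), (∀ j, f j ∈ Ar c) → ∑ j, ι i c j (f j) = 0 → ∀ j, f j = 0)
    {b : ∀ i c, JJ i c → (Yc c → ℚ)} (hb : ∀ i c j, b i c j ∈ Ar c)
    (hu : ∀ i, antiVec (Φ i) (1 : G) = ∑ c, ∑ j, ι i c j (b i c j)) :
    Submodule.span ℚ (Set.range fun x : E i₁ => fun g : G => antiVec (Φ i₁) g x) =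
        Submodule.span ℚ (Set.range fun x : E i₀ => fun g : G => antiVec (Φ i₀) g x) ↔
      ∀ c, (⨆ j, (𝒟 c).map (LinearMap.applyₗ (b i₁ c j))) = ⨆ j, (𝒟 c).map (LinearMap.applyₗ (b i₀ c j)) := by
  rw [span_coeff_eq_span_shadowCoeff_of_eq Φ i₀ (hu i₀), span_coeff_eq_span_shadowCoeff_of_eq Φ i₁ (hu i₁)]
  exact span_shadowCoeff_eq_iff_forall_iSup_eq_of_classes h𝒟 hRst hRirr hR0 hsep (ι i₀) (ι i₁) (hιeq i₀) (hιeq i₁)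
    (hind i₀) (hind i₁) (hb i₀) (hb i₁)

omit [Fintype I] in
/-- **PAIR DOMINATION ACROSS ALL ISOTYPIC CLASSES: `rank(Φ₀,Φ₁) = rank Φ₀ ⟺ ∀ c, D_c⟨b¹_c⟩ ≤ D_c⟨b⁰_c⟩`** (a two-member
family `I = {i₀, i₁}`; gen 73 K3's `MC₁ ≤ MC₀` read class by class) — gen 74 S7's criterion with BOTH slots in the
reference-irreducible currency. [cite: Deligne1982HodgeCycles, I.5 (p. 53)] [cite: Gordon1999HodgeAVSurvey, §3
Theorem (proof), 7.5–7.7 and 9.4.3] [cite: Lang2002, XVII §3] -/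
theorem typeRank_pair_eq_typeRank_iff_forall_iSup_le_of_classes [Fintype I] {ρ : G} {Φ : ∀ i, Set (E i)}
    (h : ∀ i, IsCMTypeWith ρ (Φ i)) {i₀ i₁ : I} (hI : ∀ j, j = i₀ ∨ j = i₁)
    (h𝒟 : ∀ c (L : (Yc c → ℚ) →ₗ[ℚ] (Yc c → ℚ)), L ∈ 𝒟 c ↔ (∀ a ∈ Ar c, L a ∈ Ar c) ∧
      ∀ (k : G) (a : Yc c → ℚ), a ∈ Ar c → L (fun y => a (k • y)) = fun y => L a (k • y))
    (hRst : ∀ c (k : G) (a : Yc c → ℚ), a ∈ Ar c → (fun y => a (k • y)) ∈ Ar c)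
    (hRirr : ∀ c (W : Submodule ℚ (Yc c → ℚ)), W ≤ Ar c → W ≠ ⊥ →
      (∀ (k : G) (f : Yc c → ℚ), f ∈ W → (fun y => f (k • y)) ∈ W) → W = Ar c)
    (hR0 : ∀ c, Ar c ≠ ⊥)
    (hsep : ∀ c c' (L : (Yc c → ℚ) →ₗ[ℚ] (Yc c' → ℚ)), c ≠ c' → Ar c ≠ ⊥ → (∀ a ∈ Ar c, L a ∈ Ar c') →
      (∀ a ∈ Ar c, L a = 0 → a = 0) →
      (∀ (k : G) (a : Yc c → ℚ), a ∈ Ar c → L (fun y => a (k • y)) = fun y => L a (k • y)) → False)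
    (ι : ∀ i c, JJ i c → ((Yc c → ℚ) →ₗ[ℚ] (E i → ℚ)))
    (hιeq : ∀ i c (j : JJ i c) (k : G) (a : Yc c → ℚ), a ∈ Ar c →
      ι i c j (fun y => a (k • y)) = fun y => ι i c j a (k • y))
    (hind : ∀ i c (f : JJ i c → (Yc c → ℚ)), (∀ j, f j ∈ Ar c) → ∑ j, ι i c j (f j) = 0 → ∀ j, f j = 0)
    {b : ∀ i c, JJ i c → (Yc c → ℚ)} (hb : ∀ i c j, b i c j ∈ Ar c)
    (hu : ∀ i, antiVec (Φ i) (1 : G) = ∑ c, ∑ j, ι i c j (b i c j)) :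
    typeRank G (sigmaType Φ) = typeRank G (Φ i₀) ↔
      ∀ c, (⨆ j, (𝒟 c).map (LinearMap.applyₗ (b i₁ c j))) ≤ ⨆ j, (𝒟 c).map (LinearMap.applyₗ (b i₀ c j)) := by
  rw [typeRank_sigmaType_eq_typeRank_iff_span_coeff_le_of_pair h hI]
  exact span_coeff_le_iff_forall_iSup_le_of_classes Φ i₀ i₁ h𝒟 hRst hRirr hR0 hsep ι hιeq hind hb hu

omit [Fintype I] in
/-- **HODGE EQUIVALENCE OF A PAIR: `rank(Φ₀,Φ₁) = rank Φ₀ ∧ rank(Φ₀,Φ₁) = rank Φ₁ ⟺ ∀ c, D_c⟨b¹_c⟩ = D_c⟨b⁰_c⟩`**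
(`dim MT(A₀ × A₁) = dim MT(A₀) = dim MT(A₁)`; gen 74 S2 for one class). [cite: Deligne1982HodgeCycles, I.5 (p. 53)]
[cite: Gordon1999HodgeAVSurvey, §3 Theorem (proof), 7.7] [cite: Lang2002, XVII §3] -/
theorem typeRank_pair_eq_and_eq_iff_forall_iSup_eq_of_classes [Fintype I] {ρ : G} {Φ : ∀ i, Set (E i)}
    (h : ∀ i, IsCMTypeWith ρ (Φ i)) {i₀ i₁ : I} (hI : ∀ j, j = i₀ ∨ j = i₁)
    (h𝒟 : ∀ c (L : (Yc c → ℚ) →ₗ[ℚ] (Yc c → ℚ)), L ∈ 𝒟 c ↔ (∀ a ∈ Ar c, L a ∈ Ar c) ∧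
      ∀ (k : G) (a : Yc c → ℚ), a ∈ Ar c → L (fun y => a (k • y)) = fun y => L a (k • y))
    (hRst : ∀ c (k : G) (a : Yc c → ℚ), a ∈ Ar c → (fun y => a (k • y)) ∈ Ar c)
    (hRirr : ∀ c (W : Submodule ℚ (Yc c → ℚ)), W ≤ Ar c → W ≠ ⊥ →
      (∀ (k : G) (f : Yc c → ℚ), f ∈ W → (fun y => f (k • y)) ∈ W) → W = Ar c)
    (hR0 : ∀ c, Ar c ≠ ⊥)
    (hsep : ∀ c c' (L : (Yc c → ℚ) →ₗ[ℚ] (Yc c' → ℚ)), c ≠ c' → Ar c ≠ ⊥ → (∀ a ∈ Ar c, L a ∈ Ar c') →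
      (∀ a ∈ Ar c, L a = 0 → a = 0) →
      (∀ (k : G) (a : Yc c → ℚ), a ∈ Ar c → L (fun y => a (k • y)) = fun y => L a (k • y)) → False)
    (ι : ∀ i c, JJ i c → ((Yc c → ℚ) →ₗ[ℚ] (E i → ℚ)))
    (hιeq : ∀ i c (j : JJ i c) (k : G) (a : Yc c → ℚ), a ∈ Ar c →
      ι i c j (fun y => a (k • y)) = fun y => ι i c j a (k • y))
    (hind : ∀ i c (f : JJ i c → (Yc c → ℚ)), (∀ j, f j ∈ Ar c) → ∑ j, ι i c j (f j) = 0 → ∀ j, f j = 0)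
    {b : ∀ i c, JJ i c → (Yc c → ℚ)} (hb : ∀ i c j, b i c j ∈ Ar c)
    (hu : ∀ i, antiVec (Φ i) (1 : G) = ∑ c, ∑ j, ι i c j (b i c j)) :
    (typeRank G (sigmaType Φ) = typeRank G (Φ i₀) ∧ typeRank G (sigmaType Φ) = typeRank G (Φ i₁)) ↔
      ∀ c, (⨆ j, (𝒟 c).map (LinearMap.applyₗ (b i₁ c j))) = ⨆ j, (𝒟 c).map (LinearMap.applyₗ (b i₀ c j)) := by
  rw [← span_coeff_eq_iff_typeRank_sigmaType_eq_and_eq_of_pair h hI]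
  exact span_coeff_eq_iff_forall_iSup_eq_of_classes Φ i₀ i₁ h𝒟 hRst hRirr hR0 hsep ι hιeq hind hb hu

end Family

end Summit.HodgeConjecture.CorCM.IrrOdd

/-! ### CM dress -/

namespace Summit.HodgeConjecture.CorCM

open CategoryTheory CategoryTheory.Limits NumberField Module IntermediateField
open Literature.NumberTheory.ComplexMultiplication
open Literature.AlgebraicGeometry.Motives (AbelianVariety CMType)
open Literature.AlgebraicGeometry.Motives.AbelianVariety
open Literature.AlgebraicGeometry.HodgeTheory
open Literature.AlgebraicGeometry.ComplexMultiplication (IsCMTypeRealisation)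
open Literature.AlgebraicGeometry.Pohlmann1968

variable {I : Type} [Fintype I] {K : I → Type} [∀ i, Field (K i)] [∀ i, NumberField (K i)] [∀ i, IsCMField (K i)]
  {C : Type} [Fintype C] {Yc : C → Type} [∀ c, MulAction (ℂ ≃+* ℂ) (Yc c)] [∀ c, Fintype (Yc c)]
  {Ar : ∀ c, Submodule ℚ (Yc c → ℚ)} {𝒟 : ∀ c, Submodule ℚ ((Yc c → ℚ) →ₗ[ℚ] (Yc c → ℚ))}
  {JJ : I → C → Type} [∀ i c, Fintype (JJ i c)]

/-- **PAIR DOMINATION AND HODGE EQUIVALENCE ACROSS ALL ISOTYPIC CLASSES (CM fields)**: for `I = {i₀, i₁}`,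
**`dim MT(A₀ × A₁) = dim MT(A₀) ⟺ ∀ c, D_c⟨b¹_c⟩ ≤ D_c⟨b⁰_c⟩`**. [cite: Deligne1982HodgeCycles, I.5 (p. 53)]
[cite: Gordon1999HodgeAVSurvey, §3 Theorem (proof), 7.5–7.7 and 9.4.3] [cite: Lang2002, XVII §3] -/
theorem cmFamilyRank_pair_eq_cmTypeRank_iff_forall_iSup_le_of_classes (Φ : ∀ i, CMType (K i)) {i₀ i₁ : I}
    (hI : ∀ j, j = i₀ ∨ j = i₁)
    (h𝒟 : ∀ c (L : (Yc c → ℚ) →ₗ[ℚ] (Yc c → ℚ)), L ∈ 𝒟 c ↔ (∀ a ∈ Ar c, L a ∈ Ar c) ∧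
      ∀ (k : ℂ ≃+* ℂ) (a : Yc c → ℚ), a ∈ Ar c → L (fun y => a (k • y)) = fun y => L a (k • y))
    (hRst : ∀ c (k : ℂ ≃+* ℂ) (a : Yc c → ℚ), a ∈ Ar c → (fun y => a (k • y)) ∈ Ar c)
    (hRirr : ∀ c (W : Submodule ℚ (Yc c → ℚ)), W ≤ Ar c → W ≠ ⊥ →
      (∀ (k : ℂ ≃+* ℂ) (f : Yc c → ℚ), f ∈ W → (fun y => f (k • y)) ∈ W) → W = Ar c)
    (hR0 : ∀ c, Ar c ≠ ⊥)
    (hsep : ∀ c c' (L : (Yc c → ℚ) →ₗ[ℚ] (Yc c' → ℚ)), c ≠ c' → Ar c ≠ ⊥ → (∀ a ∈ Ar c, L a ∈ Ar c') →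
      (∀ a ∈ Ar c, L a = 0 → a = 0) →
      (∀ (k : ℂ ≃+* ℂ) (a : Yc c → ℚ), a ∈ Ar c → L (fun y => a (k • y)) = fun y => L a (k • y)) → False)
    (ι : ∀ i c, JJ i c → ((Yc c → ℚ) →ₗ[ℚ] ((K i →+* ℂ) → ℚ)))
    (hιeq : ∀ i c (j : JJ i c) (k : ℂ ≃+* ℂ) (a : Yc c → ℚ), a ∈ Ar c →
      ι i c j (fun y => a (k • y)) = fun y => ι i c j a (k • y))
    (hind : ∀ i c (f : JJ i c → (Yc c → ℚ)), (∀ j, f j ∈ Ar c) → ∑ j, ι i c j (f j) = 0 → ∀ j, f j = 0)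
    {b : ∀ i c, JJ i c → (Yc c → ℚ)} (hb : ∀ i c j, b i c j ∈ Ar c)
    (hu : ∀ i, antiVec (Φ i).1 (1 : ℂ ≃+* ℂ) = ∑ c, ∑ j, ι i c j (b i c j)) :
    CMAlgebra.cmFamilyRank Φ = cmTypeRank (Φ i₀) ↔
      ∀ c, (⨆ j, (𝒟 c).map (LinearMap.applyₗ (b i₁ c j))) ≤ ⨆ j, (𝒟 c).map (LinearMap.applyₗ (b i₀ c j)) := by
  haveI : ∀ i, Nonempty (K i →+* ℂ) := fun i => inferInstance
  exact IrrOdd.typeRank_pair_eq_typeRank_iff_forall_iSup_le_of_classes (G := ℂ ≃+* ℂ) (E := fun i => K i →+* ℂ)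
    (Φ := fun i => (Φ i).1) (fun i => isCMTypeWith_conj (Φ i)) hI h𝒟 hRst hRirr hR0 hsep ι hιeq hind hb hu

/-- **HODGE EQUIVALENCE OF A PAIR (CM fields): `dim MT(A₀ × A₁) = dim MT(A₀) = dim MT(A₁) ⟺ ∀ c, D_c⟨b¹_c⟩ =
D_c⟨b⁰_c⟩`**. [cite: Deligne1982HodgeCycles, I.5 (p. 53)] [cite: Gordon1999HodgeAVSurvey, §3 Theorem (proof), 7.7]
[cite: Lang2002, XVII §3] -/
theorem cmFamilyRank_pair_eq_and_eq_iff_forall_iSup_eq_of_classes (Φ : ∀ i, CMType (K i)) {i₀ i₁ : I}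
    (hI : ∀ j, j = i₀ ∨ j = i₁)
    (h𝒟 : ∀ c (L : (Yc c → ℚ) →ₗ[ℚ] (Yc c → ℚ)), L ∈ 𝒟 c ↔ (∀ a ∈ Ar c, L a ∈ Ar c) ∧
      ∀ (k : ℂ ≃+* ℂ) (a : Yc c → ℚ), a ∈ Ar c → L (fun y => a (k • y)) = fun y => L a (k • y))
    (hRst : ∀ c (k : ℂ ≃+* ℂ) (a : Yc c → ℚ), a ∈ Ar c → (fun y => a (k • y)) ∈ Ar c)
    (hRirr : ∀ c (W : Submodule ℚ (Yc c → ℚ)), W ≤ Ar c → W ≠ ⊥ →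
      (∀ (k : ℂ ≃+* ℂ) (f : Yc c → ℚ), f ∈ W → (fun y => f (k • y)) ∈ W) → W = Ar c)
    (hR0 : ∀ c, Ar c ≠ ⊥)
    (hsep : ∀ c c' (L : (Yc c → ℚ) →ₗ[ℚ] (Yc c' → ℚ)), c ≠ c' → Ar c ≠ ⊥ → (∀ a ∈ Ar c, L a ∈ Ar c') →
      (∀ a ∈ Ar c, L a = 0 → a = 0) →
      (∀ (k : ℂ ≃+* ℂ) (a : Yc c → ℚ), a ∈ Ar c → L (fun y => a (k • y)) = fun y => L a (k • y)) → False)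
    (ι : ∀ i c, JJ i c → ((Yc c → ℚ) →ₗ[ℚ] ((K i →+* ℂ) → ℚ)))
    (hιeq : ∀ i c (j : JJ i c) (k : ℂ ≃+* ℂ) (a : Yc c → ℚ), a ∈ Ar c →
      ι i c j (fun y => a (k • y)) = fun y => ι i c j a (k • y))
    (hind : ∀ i c (f : JJ i c → (Yc c → ℚ)), (∀ j, f j ∈ Ar c) → ∑ j, ι i c j (f j) = 0 → ∀ j, f j = 0)
    {b : ∀ i c, JJ i c → (Yc c → ℚ)} (hb : ∀ i c j, b i c j ∈ Ar c)
    (hu : ∀ i, antiVec (Φ i).1 (1 : ℂ ≃+* ℂ) = ∑ c, ∑ j, ι i c j (b i c j)) :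
    (CMAlgebra.cmFamilyRank Φ = cmTypeRank (Φ i₀) ∧ CMAlgebra.cmFamilyRank Φ = cmTypeRank (Φ i₁)) ↔
      ∀ c, (⨆ j, (𝒟 c).map (LinearMap.applyₗ (b i₁ c j))) = ⨆ j, (𝒟 c).map (LinearMap.applyₗ (b i₀ c j)) := by
  haveI : ∀ i, Nonempty (K i →+* ℂ) := fun i => inferInstance
  exact IrrOdd.typeRank_pair_eq_and_eq_iff_forall_iSup_eq_of_classes (G := ℂ ≃+* ℂ) (E := fun i => K i →+* ℂ)
    (Φ := fun i => (Φ i).1) (fun i => isCMTypeWith_conj (Φ i)) hI h𝒟 hRst hRirr hR0 hsep ι hιeq hind hb hu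

end Summit.HodgeConjecture.CorCM

end
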